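import Summits.CriticalPhenomena.PercolationContinuityZ3.Theorems.PercNearOneGluingNoHeavyQuantFarCycleBlockChain
import HarnessLib

/-!
# QUANT lane R8, front "FAR beyond trees", layer one — PENDANT CYCLE BLOCKS III: the hub-count statistics of the arc model and their laws
# (`ZF, SF, ZQ, SQ` = no / one unit among the first `f` / the remaining hubs; `g1, g2` = the clockwise arm collects ≥ 1 / ≥ 2 units)

builds on p205010 (kernel theorem, internal audit signed; external expert review pending)

Support file (`--supports stmt-CriticalPhenomena-4575`), seat `prim-quant-p1` (gen 22); memo
`run/shared/lean/prim/quant/prim-quant-p1-g22/FOR-LEAD-KHUB.md` §3.  Standard axioms; no sorries.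

For a pendant cycle block (`Block.IsCycleBlock`) and a strictly increasing list `ps` of hub positions in `[1, L)`, with `C = Block.chainOf … pre ps`
(`…QuantFarCycleBlockChain`) and the statistics
* `Block.units … qs ω = Σ_{p ∈ qs} W_p(ω)` (units of the listed hubs), `Block.coll … qs ω = Σ_{p ∈ qs} 𝟙[CW ω p]·W_p(ω)` (units COLLECTED by the
  clockwise arm among the listed hubs),
this file identifies the recursively defined numbers of `…QuantFarDecLawDefs` with probabilities (`f ≤ |ps|`):
* `Block.real_units_take_eq_zero/one` — `P_w(units (ps.take f) = 0) = ZF f C`, `P_w(units (ps.take f) = 1) = SF f C`;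
* `Block.real_units_drop_eq_zero/one` — `P_w(units (ps.drop f) = 0) = ZQ |ps| f C`, `… = 1) = SQ |ps| f C`;
* **`Block.real_coll_ge_one`, `Block.real_coll_ge_two`** — `P_w(coll (ps.take f) ≥ 1) = g1 f C`, `P_w(coll (ps.take f) ≥ 2) = g2 f C`.
Each is the induction "peel the first listed hub" (independent of everything else: `Block.disjoint_hubPairs`, `Block.disjoint_cwEdges_hubPairs`),
matching the recursion through `Block.chainOf_shift`; the arm steps use that collecting anything beyond the first hub needs the arc to the first hub
(`Block.CW_of_coll_pos`).  [cite: Grimmett1999, §1.3 p. 10; §2.2]; bookkeeping [this work].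
-/

noncomputable section

namespace Summit.CriticalPhenomena.PercolationContinuityZ3.Theorems

namespace Quant

namespace Block

open Finset MeasureTheory Set
open Literature.Probability.LatticeModels
open Literature.Probability.Percolation
open Summit.CriticalPhenomena.PercolationContinuityZ3.Theorems.HairyCycle (cycE CW CCW RC)
open TwoChain (ZF SF ZQ SQ g1 g2)
open scoped Classical

variable {n : ℕ}

/-! ## The statistics -/

/-- Units of the listed hubs: `Σ_{p ∈ qs} W_p`. [this work] -/
def units (cyc : ℕ → Fin n) (S : ℕ → Finset (Fin n)) (A : Finset (Fin n)) (qs : List ℕ) (ω : BondConfig (Fin n)) : ℕ :=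
  (qs.map fun p => hubCount cyc S A p ω).sum

/-- Units collected by the clockwise arm among the listed hubs: `Σ_{p ∈ qs} 𝟙[CW p]·W_p`. [this work] -/
def coll (L : ℕ) (cyc : ℕ → Fin n) (S : ℕ → Finset (Fin n)) (A : Finset (Fin n)) (qs : List ℕ) (ω : BondConfig (Fin n)) : ℕ :=
  (qs.map fun p => if CW L cyc ω p then hubCount cyc S A p ω else 0).sum

/-- The hub pairs of the listed hubs. [this work] -/
def hubPairsL (cyc : ℕ → Fin n) (S : ℕ → Finset (Fin n)) : List ℕ → Finset (Sym2 (Fin n))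
  | [] => ∅
  | p :: qs => hubPairs (S p) (cyc p) ∪ hubPairsL cyc S qs

section Defs

variable (L : ℕ) (cyc : ℕ → Fin n) (S : ℕ → Finset (Fin n)) (A : Finset (Fin n))

/-- [this work] -/ @[simp] theorem units_nil (ω : BondConfig (Fin n)) : units cyc S A [] ω = 0 := rfl
/-- [this work] -/ @[simp] theorem units_cons (p : ℕ) (qs : List ℕ) (ω : BondConfig (Fin n)) :
    units cyc S A (p :: qs) ω = hubCount cyc S A p ω + units cyc S A qs ω := by simp [units]
/-- [this work] -/ @[simp] theorem coll_nil (ω : BondConfig (Fin n)) : coll L cyc S A [] ω = 0 := rfl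
/-- [this work] -/ @[simp] theorem coll_cons (p : ℕ) (qs : List ℕ) (ω : BondConfig (Fin n)) :
    coll L cyc S A (p :: qs) ω = (if CW L cyc ω p then hubCount cyc S A p ω else 0) + coll L cyc S A qs ω := by simp [coll]
/-- [this work] -/ @[simp] theorem hubPairsL_nil : hubPairsL cyc S [] = ∅ := rfl
/-- [this work] -/ @[simp] theorem hubPairsL_cons (p : ℕ) (qs : List ℕ) :
    hubPairsL cyc S (p :: qs) = hubPairs (S p) (cyc p) ∪ hubPairsL cyc S qs := rfl

/-- Membership in `hubPairsL`. [this work] -/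
theorem mem_hubPairsL {qs : List ℕ} {e : Sym2 (Fin n)} : e ∈ hubPairsL cyc S qs ↔ ∃ p ∈ qs, e ∈ hubPairs (S p) (cyc p) := by
  induction qs with
  | nil => simp
  | cons p qs ih => simp [ih]

/-- `units` is read off the listed hub pairs. [this work] -/
theorem readsOff_units (qs : List ℕ) : ReadsOff (units cyc S A qs) ↑(hubPairsL cyc S qs) := by
  induction qs with
  | nil => intro ω ω' _; rfl
  | cons p qs ih =>
    have h := (readsOff_hubCount cyc S A p).map₂ ih (· + ·)
    rw [hubPairsL_cons, Finset.coe_union]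
    intro ω ω' hF
    rw [units_cons, units_cons]
    exact h ω ω' hF

/-- `coll` over positions `≤ P` is read off the clockwise edges to `P` and the listed hub pairs. [this work] -/
theorem readsOff_coll {qs : List ℕ} {P : ℕ} (hqs : ∀ p ∈ qs, p ≤ P) :
    ReadsOff (coll L cyc S A qs) (↑(cwEdges L cyc P) ∪ ↑(hubPairsL cyc S qs)) := by
  induction qs with
  | nil => intro ω ω' _; rfl
  | cons p qs ih =>
    have hp : cwEdges L cyc p ⊆ cwEdges L cyc P := Finset.image_subset_image (Finset.range_mono (hqs p (by simp)))
    have h1 : ReadsOff (fun ω => if CW L cyc ω p then hubCount cyc S A p ω else 0)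
        (↑(cwEdges L cyc P) ∪ ↑(hubPairs (S p) (cyc p))) :=
      ((readsOff_CW L cyc p).mono (Finset.coe_subset.2 hp)).map₂ (readsOff_hubCount cyc S A p) fun (c : Prop) (k : ℕ) => if c then k else 0
    have h := (h1.map₂ (ih fun q hq => hqs q (by simp [hq])) (· + ·)).mono
      (G := (↑(cwEdges L cyc P) : Set (Sym2 (Fin n))) ∪ ↑(hubPairsL cyc S (p :: qs))) (by
        rw [hubPairsL_cons, Finset.coe_union]
        intro e he
        rcases he with (he | he) | (he | he)
        · exact Or.inl he
        · exact Or.inr (Or.inl he)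
        · exact Or.inl he
        · exact Or.inr (Or.inr he))
    intro ω ω' hF
    rw [coll_cons, coll_cons]
    exact h ω ω' hF

/-- Collecting a unit among hubs at positions `≥ p` needs the clockwise arc to `p`. [this work] -/
theorem CW_of_coll_pos {qs : List ℕ} {p : ℕ} (hqs : ∀ q ∈ qs, p ≤ q) {ω : BondConfig (Fin n)} (h : 0 < coll L cyc S A qs ω) : CW L cyc ω p := by
  induction qs with
  | nil => simp at h
  | cons q qs ih =>
    rw [coll_cons] at h
    by_cases hq : CW L cyc ω q
    · exact CW_anti (hqs q (by simp)) hq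
    · rw [if_neg hq, zero_add] at h
      exact ih (fun q' hq' => hqs q' (by simp [hq'])) h

end Defs

section Laws

variable {L : ℕ} {cyc : ℕ → Fin n} {S : ℕ → Finset (Fin n)} {Z : Finset (Fin n)} (H : IsCycleBlock L cyc S Z)
  (A : Finset (Fin n)) (w : Sym2 (Fin n) → unitInterval)
include H

/-- A hub's pairs avoid the pairs of a list of other hubs. [this work] -/
theorem disjoint_hubPairs_hubPairsL {p : ℕ} {qs : List ℕ} (hp : 1 ≤ p ∧ p < L) (hqs : ∀ q ∈ qs, 1 ≤ q ∧ q < L) (hpq : p ∉ qs) :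
    Disjoint (hubPairs (S p) (cyc p)) (hubPairsL cyc S qs) := by
  rw [Finset.disjoint_left]
  intro e he he'
  obtain ⟨q, hq, heq⟩ := (mem_hubPairsL cyc S).1 he'
  exact Finset.disjoint_left.1 (disjoint_hubPairs H hp.1 hp.2 (hqs q hq).1 (hqs q hq).2 (fun h => hpq (h ▸ hq))) he heq

/-- The clockwise edges avoid the pairs of a list of hubs. [this work] -/
theorem disjoint_cwEdges_hubPairsL {P : ℕ} (hP : P ≤ L) {qs : List ℕ} (hqs : ∀ q ∈ qs, 1 ≤ q ∧ q < L) :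
    Disjoint (cwEdges L cyc P) (hubPairsL cyc S qs) := by
  rw [Finset.disjoint_left]
  intro e he he'
  obtain ⟨q, hq, heq⟩ := (mem_hubPairsL cyc S).1 he'
  exact Finset.disjoint_left.1 (disjoint_cwEdges_hubPairs H hP (hqs q hq).1 (hqs q hq).2) he heq

/-- The counter-clockwise edges avoid the pairs of a list of hubs. [this work] -/
theorem disjoint_ccwEdges_hubPairsL (P : ℕ) {qs : List ℕ} (hqs : ∀ q ∈ qs, 1 ≤ q ∧ q < L) :
    Disjoint (ccwEdges L cyc P) (hubPairsL cyc S qs) := by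
  rw [Finset.disjoint_left]
  intro e he he'
  obtain ⟨q, hq, heq⟩ := (mem_hubPairsL cyc S).1 he'
  exact Finset.disjoint_left.1 (disjoint_ccwEdges_hubPairs H P (hqs q hq).1 (hqs q hq).2) he heq

/-- Two lists of hubs without common position have disjoint pair sets. [this work] -/
theorem disjoint_hubPairsL {qs qs' : List ℕ} (hqs : ∀ q ∈ qs, 1 ≤ q ∧ q < L) (hqs' : ∀ q ∈ qs', 1 ≤ q ∧ q < L)
    (h : ∀ q ∈ qs, q ∉ qs') : Disjoint (hubPairsL cyc S qs) (hubPairsL cyc S qs') := by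
  induction qs with
  | nil => simp
  | cons p qs ih =>
    rw [hubPairsL_cons, Finset.disjoint_union_left]
    exact ⟨disjoint_hubPairs_hubPairsL H (hqs p (by simp)) hqs' (h p (by simp)),
      ih (fun q hq => hqs q (by simp [hq])) (fun q hq => h q (by simp [hq]))⟩

/-! ## No unit / one unit among the first `f` hubs -/

/-- **`P_w(units (ps.take f) = 0) = ZF f C` and `P_w(units (ps.take f) = 1) = SF f C`** (`f ≤ |ps|`). [this work] -/
theorem real_units_take :
    ∀ (ps : List ℕ) (pre f : ℕ), (∀ p ∈ ps, 1 ≤ p ∧ p < L) → ps.Nodup → f ≤ ps.length →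
      (prodBernoulli w).real {ω | units cyc S A (ps.take f) ω = 0} = ZF f (chainOf L cyc S A w pre ps) ∧
      (prodBernoulli w).real {ω | units cyc S A (ps.take f) ω = 1} = SF f (chainOf L cyc S A w pre ps) := by
  have hmeas : ∀ U : Set (BondConfig (Fin n)), MeasurableSet U := fun U => (Set.toFinite U).measurableSet
  intro ps
  induction ps with
  | nil =>
    intro pre f _ _ hf
    have hf0 : f = 0 := by simpa using hf
    subst hf0
    simp only [List.take_nil, units_nil, TwoChain.ZF_zero, TwoChain.SF_zero]
    exact ⟨by simp, by simp⟩
  | cons p ps ih =>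
    intro pre f hps hnd hf
    cases f with
    | zero =>
      simp only [List.take_zero, units_nil, TwoChain.ZF_zero, TwoChain.SF_zero]
      exact ⟨by simp, by simp⟩
    | succ f =>
      have hp : 1 ≤ p ∧ p < L := hps p (by simp)
      have hps' : ∀ q ∈ ps, 1 ≤ q ∧ q < L := fun q hq => hps q (by simp [hq])
      have hnd' : ps.Nodup := (List.nodup_cons.1 hnd).2
      have hpps : p ∉ ps := (List.nodup_cons.1 hnd).1
      have hf' : f ≤ ps.length := by simpa using hf
      obtain ⟨ih0, ih1⟩ := ih p f hps' hnd' hf'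
      rw [List.take_succ_cons, TwoChain.ZF_succ, TwoChain.SF_succ, chainOf_shift]
      simp only [units_cons]
      -- independence of hub `p` from the hubs of `ps.take f`
      have hdisj : Disjoint (hubPairs (S p) (cyc p)) (hubPairsL cyc S (ps.take f)) :=
        disjoint_hubPairs_hubPairsL H hp (fun q hq => hps' q (List.mem_of_mem_take hq)) (fun h => hpps (List.mem_of_mem_take h))
      have indep : ∀ (P Q : ℕ → Prop), (prodBernoulli w).real ({ω | P (hubCount cyc S A p ω)} ∩ {ω | Q (units cyc S A (ps.take f) ω)}) =
          (prodBernoulli w).real {ω | P (hubCount cyc S A p ω)} * (prodBernoulli w).real {ω | Q (units cyc S A (ps.take f) ω)} :=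
        fun P Q => prodBernoulli_real_inter_of_determinedBy_disjoint w hdisj ((readsOff_hubCount cyc S A p).determinedBy P)
          ((readsOff_units cyc S A (ps.take f)).determinedBy Q) (hmeas _) (hmeas _)
      have hz1 : (chainOf L cyc S A w pre (p :: ps)).z 1 = hz cyc S A w p := by simp [chainOf]
      have hs1 : (chainOf L cyc S A w pre (p :: ps)).s 1 = hs cyc S A w p := by simp [chainOf]
      constructor
      · have e : {ω : BondConfig (Fin n) | hubCount cyc S A p ω + units cyc S A (ps.take f) ω = 0} =
            {ω | hubCount cyc S A p ω = 0} ∩ {ω | units cyc S A (ps.take f) ω = 0} := by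
          ext ω; simp only [mem_setOf_eq, Set.mem_inter_iff]; omega
        rw [e, indep (fun k => k = 0) (fun k => k = 0), ih0, hz1]; rfl
      · have e : {ω : BondConfig (Fin n) | hubCount cyc S A p ω + units cyc S A (ps.take f) ω = 1} =
            ({ω | hubCount cyc S A p ω = 1} ∩ {ω | units cyc S A (ps.take f) ω = 0}) ∪
            ({ω | hubCount cyc S A p ω = 0} ∩ {ω | units cyc S A (ps.take f) ω = 1}) := by
          ext ω; simp only [mem_setOf_eq, Set.mem_inter_iff, Set.mem_union]; omega
        have hd : Disjoint ({ω : BondConfig (Fin n) | hubCount cyc S A p ω = 1} ∩ {ω | units cyc S A (ps.take f) ω = 0})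
            ({ω | hubCount cyc S A p ω = 0} ∩ {ω | units cyc S A (ps.take f) ω = 1}) := by
          rw [Set.disjoint_left]; rintro ω ⟨h1, -⟩ ⟨h0, -⟩; simp only [mem_setOf_eq] at h1 h0; omega
        rw [e, measureReal_union hd (hmeas _), indep (fun k => k = 1) (fun k => k = 0), indep (fun k => k = 0) (fun k => k = 1),
          ih0, ih1, hz1, hs1]
        rfl

/-! ## No unit / one unit among the remaining hubs -/

/-- **`P_w(units (ps.drop f) = 0) = ZQ |ps| f C` and `P_w(units (ps.drop f) = 1) = SQ |ps| f C`.** [this work] -/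
theorem real_units_drop :
    ∀ (ps : List ℕ) (pre f : ℕ), (∀ p ∈ ps, 1 ≤ p ∧ p < L) → ps.Nodup →
      (prodBernoulli w).real {ω | units cyc S A (ps.drop f) ω = 0} = ZQ ps.length f (chainOf L cyc S A w pre ps) ∧
      (prodBernoulli w).real {ω | units cyc S A (ps.drop f) ω = 1} = SQ ps.length f (chainOf L cyc S A w pre ps) := by
  intro ps
  induction ps with
  | nil =>
    intro pre f _ _
    cases f with
    | zero =>
      simp only [List.drop_nil, units_nil, List.length_nil, TwoChain.ZQ_zero_right, TwoChain.SQ_zero_right, TwoChain.ZF_zero,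
        TwoChain.SF_zero]
      exact ⟨by simp, by simp⟩
    | succ f =>
      simp only [List.drop_nil, units_nil, List.length_nil, TwoChain.ZQ_zero_succ, TwoChain.SQ_zero_succ]
      exact ⟨by simp, by simp⟩
  | cons p ps ih =>
    intro pre f hps hnd
    cases f with
    | zero =>
      rw [List.drop_zero, List.length_cons, TwoChain.ZQ_zero_right, TwoChain.SQ_zero_right]
      have h := real_units_take H A w (p :: ps) pre (ps.length + 1) hps hnd (by simp)
      rw [show (p :: ps).take (ps.length + 1) = p :: ps by simp] at h
      exact h
    | succ f =>
      rw [List.drop_succ_cons, List.length_cons, TwoChain.ZQ_succ_succ, TwoChain.SQ_succ_succ, chainOf_shift]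
      exact ih p f (fun q hq => hps q (by simp [hq])) (List.nodup_cons.1 hnd).2

/-- `P_w(units (ps.drop f) = 0) = ZQ |ps| f C`. [this work] -/
theorem real_units_drop_eq_zero {ps : List ℕ} (hps : ∀ p ∈ ps, 1 ≤ p ∧ p < L) (hnd : ps.Nodup) (pre f : ℕ) :
    (prodBernoulli w).real {ω | units cyc S A (ps.drop f) ω = 0} = ZQ ps.length f (chainOf L cyc S A w pre ps) :=
  (real_units_drop H A w ps pre f hps hnd).1

/-- `P_w(units (ps.drop f) = 1) = SQ |ps| f C`. [this work] -/
theorem real_units_drop_eq_one {ps : List ℕ} (hps : ∀ p ∈ ps, 1 ≤ p ∧ p < L) (hnd : ps.Nodup) (pre f : ℕ) :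
    (prodBernoulli w).real {ω | units cyc S A (ps.drop f) ω = 1} = SQ ps.length f (chainOf L cyc S A w pre ps) :=
  (real_units_drop H A w ps pre f hps hnd).2

omit H in
/-- `P_w(units qs ≥ 2) = 1 − P_w(units qs = 0) − P_w(units qs = 1)`. [this work] -/
theorem real_units_ge_two (qs : List ℕ) :
    (prodBernoulli w).real {ω | 2 ≤ units cyc S A qs ω} =
      1 - (prodBernoulli w).real {ω | units cyc S A qs ω = 0} - (prodBernoulli w).real {ω | units cyc S A qs ω = 1} := by
  have hmeas : ∀ U : Set (BondConfig (Fin n)), MeasurableSet U := fun U => (Set.toFinite U).measurableSet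
  have e : {ω : BondConfig (Fin n) | 2 ≤ units cyc S A qs ω} = ({ω | units cyc S A qs ω = 0} ∪ {ω | units cyc S A qs ω = 1})ᶜ := by
    ext ω; simp only [mem_setOf_eq, Set.mem_compl_iff, Set.mem_union]; omega
  have hd : Disjoint {ω : BondConfig (Fin n) | units cyc S A qs ω = 0} {ω | units cyc S A qs ω = 1} := by
    rw [Set.disjoint_left]; intro ω h0 h1; simp only [mem_setOf_eq] at h0 h1; omega
  rw [e, probReal_compl_eq_one_sub (hmeas _), measureReal_union hd (hmeas _)]; ring

/-! ## The clockwise arm collects -/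

/-- **`P_w(coll (ps.take f) ≥ 1) = g1 f C` and `P_w(coll (ps.take f) ≥ 2) = g2 f C`** for a strictly increasing list of positions in `[1, L)`,
`f ≤ |ps|`. [this work] -/
theorem real_coll_take :
    ∀ (ps : List ℕ) (pre f : ℕ), (∀ p ∈ ps, 1 ≤ p ∧ p < L) → ps.Pairwise (· < ·) → f ≤ ps.length →
      (prodBernoulli w).real {ω | 1 ≤ coll L cyc S A (ps.take f) ω} = g1 f (chainOf L cyc S A w pre ps) ∧
      (prodBernoulli w).real {ω | 2 ≤ coll L cyc S A (ps.take f) ω} = g2 f (chainOf L cyc S A w pre ps) := by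
  have hmeas : ∀ U : Set (BondConfig (Fin n)), MeasurableSet U := fun U => (Set.toFinite U).measurableSet
  have hL := H.hL
  intro ps
  induction ps with
  | nil =>
    intro pre f _ _ hf
    have hf0 : f = 0 := by simpa using hf
    subst hf0
    simp only [List.take_nil, coll_nil, TwoChain.g1_zero, TwoChain.g2_zero]
    exact ⟨by simp, by simp⟩
  | cons p ps ih =>
    intro pre f hps hsort hf
    cases f with
    | zero =>
      simp only [List.take_zero, coll_nil, TwoChain.g1_zero, TwoChain.g2_zero]
      exact ⟨by simp, by simp⟩
    | succ f =>
      have hp : 1 ≤ p ∧ p < L := hps p (by simp)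
      have hps' : ∀ q ∈ ps, 1 ≤ q ∧ q < L := fun q hq => hps q (by simp [hq])
      rw [List.pairwise_cons] at hsort
      have hpps : p ∉ ps := fun h => lt_irrefl p (hsort.1 p h)
      have hf' : f ≤ ps.length := by simpa using hf
      obtain ⟨ih1, ih2⟩ := ih p f hps' hsort.2 hf'
      rw [List.take_succ_cons, TwoChain.g1_succ, TwoChain.g2_succ, chainOf_shift]
      simp only [coll_cons]
      set tk := ps.take f with htk
      have htk' : ∀ q ∈ tk, 1 ≤ q ∧ q < L := fun q hq => hps' q (List.mem_of_mem_take hq)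
      have hptk : ∀ q ∈ tk, p ≤ q := fun q hq => (hsort.1 q (List.mem_of_mem_take hq)).le
      -- collecting in the tail forces `CW p`
      have hCW : ∀ ω, 1 ≤ coll L cyc S A tk ω → CW L cyc ω p := fun ω h => CW_of_coll_pos L cyc S A hptk h
      -- determining sets and independence
      have dW : ∀ P : ℕ → Prop, DeterminedBy {ω | P (hubCount cyc S A p ω)} (↑(hubPairs (S p) (cyc p)) : Set (Sym2 (Fin n))) :=
        fun P => (readsOff_hubCount cyc S A p).determinedBy P
      have dCW : DeterminedBy {ω | CW L cyc ω p} (↑(cwEdges L cyc p) : Set (Sym2 (Fin n))) := (readsOff_CW L cyc p).determinedBy id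
      have dT : ∀ Q : ℕ → Prop, DeterminedBy {ω | Q (coll L cyc S A tk ω)} (↑(cwEdges L cyc L ∪ hubPairsL cyc S tk) : Set (Sym2 (Fin n))) := by
        intro Q
        have h := (readsOff_coll L cyc S A (fun q hq => (htk' q hq).2.le)).determinedBy Q
        rw [Finset.coe_union]; exact h
      have hd1 : Disjoint (cwEdges L cyc p) (hubPairs (S p) (cyc p)) := disjoint_cwEdges_hubPairs H hp.2.le hp.1 hp.2
      have hd2 : Disjoint (hubPairs (S p) (cyc p)) (cwEdges L cyc L ∪ hubPairsL cyc S tk) := by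
        rw [Finset.disjoint_union_right]
        exact ⟨(disjoint_cwEdges_hubPairs H le_rfl hp.1 hp.2).symm,
          disjoint_hubPairs_hubPairsL H hp htk' (fun h => hpps (List.mem_of_mem_take h))⟩
      have indep1 : ∀ P : ℕ → Prop, (prodBernoulli w).real ({ω | CW L cyc ω p} ∩ {ω | P (hubCount cyc S A p ω)}) =
          cwProb L cyc w p * (prodBernoulli w).real {ω | P (hubCount cyc S A p ω)} := by
        intro P
        rw [prodBernoulli_real_inter_of_determinedBy_disjoint w hd1 dCW (dW P) (hmeas _) (hmeas _), real_CW w H hp.2.le]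
      have indep2 : ∀ (P Q : ℕ → Prop), (prodBernoulli w).real ({ω | P (hubCount cyc S A p ω)} ∩ {ω | Q (coll L cyc S A tk ω)}) =
          (prodBernoulli w).real {ω | P (hubCount cyc S A p ω)} * (prodBernoulli w).real {ω | Q (coll L cyc S A tk ω)} :=
        fun P Q => prodBernoulli_real_inter_of_determinedBy_disjoint w hd2 (dW P) (dT Q) (hmeas _) (hmeas _)
      have hA1 : (chainOf L cyc S A w pre (p :: ps)).A 1 = cwProb L cyc w p := by simp [chainOf]
      have hu1 : (chainOf L cyc S A w pre (p :: ps)).u 1 = hs cyc S A w p + hd cyc S A w p := by simp [TwoChain.u, chainOf]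
      have hz1 : (chainOf L cyc S A w pre (p :: ps)).z 1 = hz cyc S A w p := by simp [chainOf]
      have hs1 : (chainOf L cyc S A w pre (p :: ps)).s 1 = hs cyc S A w p := by simp [chainOf]
      have hd1' : (chainOf L cyc S A w pre (p :: ps)).d 1 = hd cyc S A w p := by simp [chainOf]
      constructor
      · -- `≥ 1`: (CW p ∧ W_p ≥ 1) ⊔ (W_p = 0 ∧ tail ≥ 1)
        have e : {ω : BondConfig (Fin n) | 1 ≤ (if CW L cyc ω p then hubCount cyc S A p ω else 0) + coll L cyc S A tk ω} =
            ({ω | CW L cyc ω p} ∩ {ω | 1 ≤ hubCount cyc S A p ω}) ∪ ({ω | hubCount cyc S A p ω = 0} ∩ {ω | 1 ≤ coll L cyc S A tk ω}) := by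
          ext ω
          simp only [mem_setOf_eq, Set.mem_union, Set.mem_inter_iff]
          by_cases hc : CW L cyc ω p
          · simp only [hc, if_true, true_and]; omega
          · simp only [hc, if_false, zero_add, false_and, false_or]
            exact ⟨fun h => absurd (hCW ω h) hc, fun h => h.2⟩
        have hd : Disjoint ({ω : BondConfig (Fin n) | CW L cyc ω p} ∩ {ω | 1 ≤ hubCount cyc S A p ω})
            ({ω | hubCount cyc S A p ω = 0} ∩ {ω | 1 ≤ coll L cyc S A tk ω}) := by
          rw [Set.disjoint_left]; rintro ω ⟨-, h1⟩ ⟨h0, -⟩; simp only [mem_setOf_eq] at h1 h0; omega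
        rw [e, measureReal_union hd (hmeas _), indep1 (fun k => 1 ≤ k), indep2 (fun k => k = 0) (fun k => 1 ≤ k), ih1,
          real_hubCount_ge_one, hA1, hu1, hz1]
        rfl
      · -- `≥ 2`: (CW p ∧ W_p ≥ 2) ⊔ (W_p = 1 ∧ tail ≥ 1) ⊔ (W_p = 0 ∧ tail ≥ 2)
        have e : {ω : BondConfig (Fin n) | 2 ≤ (if CW L cyc ω p then hubCount cyc S A p ω else 0) + coll L cyc S A tk ω} =
            (({ω | CW L cyc ω p} ∩ {ω | 2 ≤ hubCount cyc S A p ω}) ∪ ({ω | hubCount cyc S A p ω = 1} ∩ {ω | 1 ≤ coll L cyc S A tk ω})) ∪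
            ({ω | hubCount cyc S A p ω = 0} ∩ {ω | 2 ≤ coll L cyc S A tk ω}) := by
          ext ω
          simp only [mem_setOf_eq, Set.mem_union, Set.mem_inter_iff]
          by_cases hc : CW L cyc ω p
          · simp only [hc, if_true, true_and]; omega
          · simp only [hc, if_false, zero_add, false_and, false_or]
            constructor
            · intro h; exact absurd (hCW ω (by omega)) hc
            · rintro (⟨-, h⟩ | ⟨-, h⟩)
              · exact absurd (hCW ω h) hc
              · exact h
        have hdA : Disjoint ({ω : BondConfig (Fin n) | CW L cyc ω p} ∩ {ω | 2 ≤ hubCount cyc S A p ω})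
            ({ω | hubCount cyc S A p ω = 1} ∩ {ω | 1 ≤ coll L cyc S A tk ω}) := by
          rw [Set.disjoint_left]; rintro ω ⟨-, h1⟩ ⟨h0, -⟩; simp only [mem_setOf_eq] at h1 h0; omega
        have hdB : Disjoint (({ω : BondConfig (Fin n) | CW L cyc ω p} ∩ {ω | 2 ≤ hubCount cyc S A p ω}) ∪
            ({ω | hubCount cyc S A p ω = 1} ∩ {ω | 1 ≤ coll L cyc S A tk ω}))
            ({ω | hubCount cyc S A p ω = 0} ∩ {ω | 2 ≤ coll L cyc S A tk ω}) := by
          rw [Set.disjoint_left]; rintro ω (⟨-, h1⟩ | ⟨h1, -⟩) ⟨h0, -⟩ <;> simp only [mem_setOf_eq] at h1 h0 <;> omega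
        rw [e, measureReal_union hdB (hmeas _), measureReal_union hdA (hmeas _), indep1 (fun k => 2 ≤ k),
          indep2 (fun k => k = 1) (fun k => 1 ≤ k), indep2 (fun k => k = 0) (fun k => 2 ≤ k), ih1, ih2, hA1, hz1, hs1, hd1']
        rfl

/-- `P_w(coll (ps.take f) ≥ 1) = g1 f C`. [this work] -/
theorem real_coll_ge_one {ps : List ℕ} (hps : ∀ p ∈ ps, 1 ≤ p ∧ p < L) (hsort : ps.Pairwise (· < ·)) (pre : ℕ) {f : ℕ}
    (hf : f ≤ ps.length) :
    (prodBernoulli w).real {ω | 1 ≤ coll L cyc S A (ps.take f) ω} = g1 f (chainOf L cyc S A w pre ps) :=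
  (real_coll_take H A w ps pre f hps hsort hf).1

/-- `P_w(coll (ps.take f) ≥ 2) = g2 f C`. [this work] -/
theorem real_coll_ge_two {ps : List ℕ} (hps : ∀ p ∈ ps, 1 ≤ p ∧ p < L) (hsort : ps.Pairwise (· < ·)) (pre : ℕ) {f : ℕ}
    (hf : f ≤ ps.length) :
    (prodBernoulli w).real {ω | 2 ≤ coll L cyc S A (ps.take f) ω} = g2 f (chainOf L cyc S A w pre ps) :=
  (real_coll_take H A w ps pre f hps hsort hf).2

end Laws

end Block

end Quant

end Summit.CriticalPhenomena.PercolationContinuityZ3.Theorems
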